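import Literature.AlgebraicGeometry.GroupSchemes.CartierDualAnnihilatorOfDuality
import Literature.AlgebraicGeometry.GroupSchemes.CartierDualLagrangian
import Literature.AlgebraicGeometry.GroupSchemes.AffineGroupSchemeHopfAlgebra
import Literature.AlgebraicGeometry.Motives.AbelianVarietyFrobeniusKernelTorsion
import Literature.AlgebraicGeometry.Motives.AbelianVarietyFrobeniusKernelBlocks
import Literature.AlgebraicGeometry.Motives.AbelianVarietyTorsion
import Literature.AlgebraicGeometry.AbelianSchemes.AbelianSchemePolarization
import Literature.AlgebraicGeometry.AbelianSchemes.AbelianSchemeDualIsogenyHom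
import Literature.AlgebraicGeometry.AbelianSchemes.DualIsogenyDegree
import Literature.AlgebraicGeometry.AbelianSchemes.AbelianSchemeOverField
import HarnessLib

/-!
# Transport of a Weil duality along a polarization prime to `p`: the hermitian duality `e_λ` on `A[q]` with `A[F_q]` Lagrangian

Layer `Literature/AlgebraicGeometry/AbelianSchemes`, namespace `Literature.AlgebraicGeometry.AbelianSchemes.AbelianSchemeOver.DualPair`
(§0 generic bricks in `Literature.AlgebraicGeometry.GroupSchemes.AffineGroupScheme` ∕ `…GroupSchemeKernel`).  THEOREMS ONLY (no definition, no
named fact, no instance, no notation, no `sorry`).  Cell `hodgecm-mathlib`, programme P6 «MOD», organ **(T-W3) «POLARIZATION TRANSPORT»** = the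
socket (W3) `PolarizationTransport` of the line `Cruxes/HLiu418/Lines/F0_P6b_WeilCartierDuality.lean` (cand v2, A-p01 (g24) for F0P6b-plan (g3),
2026-09-01), in GENERIC currency: the Weil family is replaced by ONE duality `w : Ĝ ≅ G^D` for the abelian variety at hand together with exactly
the two properties the transport uses — naturality in ENDOMORPHISMS and the Frobenius-annihilator law — so that `stub_W3` is one `exact`.
`--supports stmt-HodgeConjecture-24832`, count-neutral.  HC_CM is proved only modulo the printed citations until rung 0 closes.

## Mathematics ([MumfordAV1970] §20 (I) p. 189, §23; [Oda1969] Cor. 1.3)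

Data over a field `k` of exponential characteristic `p`, `q = p^r`: an abelian variety `A` with a NORMALISED dual pair `D = (Â, 𝒫)` (`hD`) and a
polarization `λ`; realisations `j : G ↪ A` of `A[q]`, `ĵ : Ĝ ↪ Â` of `Â[q]`, `φ : Φ ↪ G` of `A[F_q]` (all-`T`); `hlam` («`λ|_{A[q]}` kills no
non-trivial `T`-point»); a homomorphic duality `w : Ĝ ≅ G^D` NATURAL IN ENDOMORPHISMS (`βd ≫ w = w ≫ β^D` for lifts `β` of `f`, `βd` of `f^∨`)
and ANNIHILATING FROBENIUS (`(A[F_q])^{⊥_w} = Â[F_q]` in points); labels `O`, bare `star`∕`act`, lifts `β a`, Rosati `hRos`.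
§1 the lift `ℓ : G → Ĝ` of `λ|_{A[q]}` exists, is a homomorphism, a MONOMORPHISM by `hlam`, a closed immersion (finite + mono), an ISOMORPHISM
(`rk Ĝ = rk G^D = rk G`, ★ `isIso_of_isClosedImmersion_of_finrank_alg_eq`).  §2 HERMITIAN: `ι(a)^∨` is a homomorphism (★ `isMonHom_dualIsogenyOver`,
`hD`) so it lifts to `βd`; `hRos` + `ĵ` mono give `β(a†) ≫ ℓ = ℓ ≫ βd`, naturality gives `βd ≫ w = w ≫ (β a)^D`; so `e₀ := ℓ ≫ w` is hermitian — no
`λ^∨ = λ`, no `star ∘ star = id`.  §3 LAGRANGIAN: `x ∈ Φ^{⊥ e₀} ⟺ ℓ x ∈ Φ^{⊥ w} ⟺ ℓ x ∈ Â[F_q] ⟺ (x ≫ j ≫ λ) ≫ F_Â = 1 ⟺ (x ≫ j) ≫ F_A = 1 ⟺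
x ∈ Φ`, the fourth step by the absolute-Frobenius criterion ★ `AbelianVariety.comp_relFrobenius_eq_one_iff` on both sides and `hlam` over the
re-based `k`-scheme `(T, F_T^{abs} ≫ str)` — no twist of `λ`, no degree, no perfectness.  §4 HEAD `exists_hermitian_lagrangian_duality_of_weil`:
VERBATIM the conclusion of `WeilCartierDualityLagrangian` ∕ the hypotheses `(e₀, hherm₀, hlag₀)` of (BLF).

## References
* [MumfordAV1970] D. Mumford, *Abelian Varieties* (1970), §15 Thm. 1 (p. 143), §20 pp. 186–189, §23.
* [Oda1969] T. Oda, *The first de Rham cohomology group and Dieudonné modules*, Ann. Sci. ÉNS (4) 2 (1969), Cor. 1.3.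
* [Tate1997FiniteFlatGroupSchemes] J. Tate, *Finite flat group schemes* (1997), §(3.7)–(3.8).
* [SGA3I] M. Demazure, A. Grothendieck, *SGA 3* tome I, VII_A 4.1 (relative Frobenius).
* [GortzWedhorn2020] U. Görtz, T. Wedhorn, *Algebraic Geometry I* (2nd ed. 2020), Def. 12.9, Prop. 12.10, Definition 4.45 (2).
-/

set_option autoImplicit false

-- Mathlib's `Over`/`Scheme` APIs are stated across semireducible wrappers (as in the ★ `GroupSchemes/*` files).
set_option backward.isDefEq.respectTransparency false

noncomputable section

universe u

open CategoryTheory CategoryTheory.Limits AlgebraicGeometry MonoidalCategory CartesianMonoidalCategory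
open scoped MonObj

/-! ## §0 Generic bricks -/

namespace Literature.AlgebraicGeometry.GroupSchemes.AffineGroupScheme

open Literature.AlgebraicGeometry.Motives

/-- **An affine `R`-scheme with `Γ` a finite `R`-module is FINITE over `R`** (converse of ★ `Alg.moduleFinite`): `G → Spec R` is
`G ≅ Spec Γ(G) → Spec R`, the second arrow `Spec` of the finite structure map (★ `isoSpec_hom_comp_SpecMap_algebraMapΓ`).
[cite: GortzWedhorn2020, Definition 12.9 and Proposition 12.10] -/
theorem isFinite_hom_of_finite_alg {R : Type u} [CommRing R] (G : SchemeOver R) [IsAffine G.left] [Module.Finite R (Alg G)] :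
    IsFinite G.hom := by
  have h1 : (algebraMap R (Alg G)).Finite := RingHom.finite_algebraMap.mpr inferInstance
  haveI : IsFinite (Spec.map (algebraMapΓ G.hom)) := (IsFinite.SpecMap_iff _).mpr h1
  rw [← isoSpec_hom_comp_SpecMap_algebraMapΓ G.hom]
  infer_instance

end Literature.AlgebraicGeometry.GroupSchemes.AffineGroupScheme

namespace Literature.AlgebraicGeometry.GroupSchemes.GroupSchemeKernel

/-- Points of a kernel: a `T`-point `t` of `G` factors through `ι : Ker f ↪ G` iff `t ≫ f = 1` (★ `kerLift`, ★ `kerι_comp`).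
[cite: GortzWedhorn2020, Definition 4.45 (2) (p. 117)] -/
theorem exists_comp_kerι_eq_iff {C : Type*} [Category C] [CartesianMonoidalCategory C] {G H : C} [GrpObj H]
    (f : G ⟶ H) [HasPullback f η[H]] {T : C} (t : T ⟶ G) :
    (∃ s : T ⟶ ker f, s ≫ kerι f = t) ↔ t ≫ f = 1 := by
  constructor
  · rintro ⟨s, hs⟩
    rw [← hs, Category.assoc, kerι_comp, MonObj.comp_one]
  · intro ht
    exact ⟨kerLift t ht, kerLift_ι t ht⟩

end Literature.AlgebraicGeometry.GroupSchemes.GroupSchemeKernel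

namespace Literature.AlgebraicGeometry.AbelianSchemes

namespace AbelianSchemeOver

namespace DualPair

open Literature.AlgebraicGeometry.GroupSchemes Literature.AlgebraicGeometry.GroupSchemes.GroupSchemeKernel
open Literature.AlgebraicGeometry.GroupSchemes.AffineGroupScheme
open Literature.AlgebraicGeometry.Motives Literature.AlgebraicGeometry.Motives.AbelianVariety

variable {k : Type u} [Field k]

/-! ## §1 The lift `ℓ : G → Ĝ` of `λ|_{A[q]}` -/

/-- **A homomorphism of abelian `k`-schemes commutes with `[n]`**: `ψ ≫ [n]_B = [n]_{A′} ≫ ψ` (both are `n • ψ` in the preadditive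
category of abelian varieties, ★ `homOfIsMonHom`). [cite: MumfordAV1970, §19 Thm. 3 (p. 176)] -/
theorem comp_zsmul_id_hom_eq {A' B : AbelianSchemeOver (Spec (.of k))} (ψ : A'.X ⟶ B.X) [IsMonHom ψ] (n : ℤ) :
    ψ ≫ (n • 𝟙 B.toAffine.toAbelianVariety).hom.hom.hom = (n • 𝟙 A'.toAffine.toAbelianVariety).hom.hom.hom ≫ ψ := by
  have hAV : homOfIsMonHom ψ ≫ (n • 𝟙 B.toAffine.toAbelianVariety) = (n • 𝟙 A'.toAffine.toAbelianVariety) ≫ homOfIsMonHom ψ := by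
    rw [Preadditive.comp_zsmul, Preadditive.zsmul_comp, Category.comp_id, Category.id_comp]
  have e := congrArg (fun f => f.hom.hom.hom) hAV
  exact e

/-- **The lift `ℓ : G → Ĝ` of `λ|_{A[q]}` EXISTS** (`ℓ ≫ ĵ = j ≫ λ`): `λ` is a homomorphism, so `(j ≫ λ) ≫ [q]_Â = (j ≫ [q]_A) ≫ λ = 1 ≫ λ = 1`,
and `Ĝ` has the all-`T` description of `Â[q]`. [cite: MumfordAV1970, §20 p. 186] -/
theorem exists_lift_lam (p : ℕ) [ExpChar k p] (r : ℕ) (A : AbelianVariety k)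
    (D : (AbelianScheme.ofAbelianVariety A).toOver.DualPair) (pol : (AbelianScheme.ofAbelianVariety A).toOver.Polarization D)
    {G : SchemeOver k} [GrpObj G] (j : G ⟶ A.X)
    (hG : ∀ ⦃T : SchemeOver k⦄ (t : T ⟶ A.X), (∃ s : T ⟶ G, s ≫ j = t) ↔ t ≫ ((((p ^ r : ℕ) : ℤ) • 𝟙 A).hom.hom.hom) = 1)
    {Ĝ : SchemeOver k} (ĵ : Ĝ ⟶ D.hat.X)
    (hĜ : ∀ ⦃T : SchemeOver k⦄ (t : T ⟶ D.hat.X),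
      (∃ s : T ⟶ Ĝ, s ≫ ĵ = t) ↔ t ≫ ((((p ^ r : ℕ) : ℤ) • 𝟙 D.hat.toAffine.toAbelianVariety).hom.hom.hom) = 1) :
    ∃ ℓ : G ⟶ Ĝ, ℓ ≫ ĵ = j ≫ pol.lam := by
  haveI := pol.isMonHom
  refine (hĜ (j ≫ pol.lam)).mpr ?_
  have hj : j ≫ ((((p ^ r : ℕ) : ℤ) • 𝟙 A).hom.hom.hom) = 1 := (hG j).mp ⟨𝟙 G, Category.id_comp j⟩
  have e := comp_zsmul_id_hom_eq (A' := (AbelianScheme.ofAbelianVariety A).toOver) (B := D.hat) pol.lam ((p ^ r : ℕ) : ℤ)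
  rw [Category.assoc, e, ← Category.assoc]
  change (j ≫ ((((p ^ r : ℕ) : ℤ) • 𝟙 A).hom.hom.hom)) ≫ pol.lam = 1
  rw [hj, MonObj.one_comp]

/-- A closed immersion of `k`-schemes is a monomorphism in `Over (Spec k)`. [cite: GortzWedhorn2020, Definition 4.45 (2) (p. 117)] -/
theorem mono_of_isClosedImmersion_left {X Y : SchemeOver k} (ĵ : X ⟶ Y) [IsClosedImmersion ĵ.left] : Mono ĵ := by
  haveI : Mono ĵ.left := inferInstance
  exact Over.mono_of_mono_left ĵ

/-- The lift `ℓ` is a homomorphism (`ℓ ≫ ĵ = j ≫ λ` is one and `ĵ` is a monomorphism, ★ `isMonHom_of_comp`). [cite: MumfordAV1970, §20 p. 186] -/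
theorem isMonHom_lift {A : AbelianVariety k} {D : (AbelianScheme.ofAbelianVariety A).toOver.DualPair}
    (pol : (AbelianScheme.ofAbelianVariety A).toOver.Polarization D)
    {G : SchemeOver k} [GrpObj G] {j : G ⟶ A.X} [IsMonHom j]
    {Ĝ : SchemeOver k} [GrpObj Ĝ] {ĵ : Ĝ ⟶ D.hat.X} [IsMonHom ĵ] [IsClosedImmersion ĵ.left]
    (ℓ : G ⟶ Ĝ) (hℓ : ℓ ≫ ĵ = j ≫ pol.lam) : IsMonHom ℓ := by
  haveI := pol.isMonHom
  haveI := mono_of_isClosedImmersion_left ĵ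
  haveI : IsMonHom (ℓ ≫ ĵ) := by rw [hℓ]; infer_instance
  exact isMonHom_of_comp ĵ ℓ

/-- **The lift `ℓ` is a MONOMORPHISM** by `hlam`: if `t₁ ≫ ℓ = t₂ ≫ ℓ` then `(t₁ / t₂) ≫ j ≫ λ = (t₁ / t₂) ≫ ℓ ≫ ĵ = 1`, so `t₁ / t₂ = 1`.
[cite: MumfordAV1970, §20 p. 186] -/
theorem mono_lift {A : AbelianVariety k} {D : (AbelianScheme.ofAbelianVariety A).toOver.DualPair}
    (pol : (AbelianScheme.ofAbelianVariety A).toOver.Polarization D)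
    {G : SchemeOver k} [GrpObj G] {j : G ⟶ A.X} [IsMonHom j]
    (hlam : ∀ ⦃T : SchemeOver k⦄ (t : T ⟶ G), (t ≫ j) ≫ pol.lam = 1 → t = 1)
    {Ĝ : SchemeOver k} [GrpObj Ĝ] {ĵ : Ĝ ⟶ D.hat.X} [IsMonHom ĵ] [IsClosedImmersion ĵ.left]
    (ℓ : G ⟶ Ĝ) (hℓ : ℓ ≫ ĵ = j ≫ pol.lam) : Mono ℓ := by
  haveI := pol.isMonHom
  haveI := isMonHom_lift pol ℓ hℓ
  refine ⟨fun {T} t₁ t₂ h => ?_⟩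
  have h1 : (t₁ / t₂) ≫ ℓ = 1 := by
    rw [GrpObj.div_comp, h, div_self']
  have h2 : ((t₁ / t₂) ≫ j) ≫ pol.lam = 1 := by
    rw [Category.assoc, ← hℓ, ← Category.assoc, h1, MonObj.one_comp]
  have h3 := hlam (t₁ / t₂) h2
  rwa [div_eq_one] at h3

/-- The lift `ℓ` is a CLOSED IMMERSION: a monomorphism between finite `k`-schemes is finite (Mathlib `IsFinite.of_comp`), and finite
monomorphisms are closed immersions (Mathlib `IsClosedImmersion.iff_isFinite_and_mono`). [cite: GortzWedhorn2020, Definition 12.9 and Proposition 12.10] -/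
theorem isClosedImmersion_lift_left {A : AbelianVariety k} {D : (AbelianScheme.ofAbelianVariety A).toOver.DualPair}
    (pol : (AbelianScheme.ofAbelianVariety A).toOver.Polarization D)
    {G : SchemeOver k} [GrpObj G] [IsAffine G.left] [Module.Finite k (Alg G)] {j : G ⟶ A.X} [IsMonHom j]
    (hlam : ∀ ⦃T : SchemeOver k⦄ (t : T ⟶ G), (t ≫ j) ≫ pol.lam = 1 → t = 1)
    {Ĝ : SchemeOver k} [GrpObj Ĝ] [IsAffine Ĝ.left] [Module.Finite k (Alg Ĝ)] {ĵ : Ĝ ⟶ D.hat.X} [IsMonHom ĵ] [IsClosedImmersion ĵ.left]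
    (ℓ : G ⟶ Ĝ) (hℓ : ℓ ≫ ĵ = j ≫ pol.lam) : IsClosedImmersion ℓ.left := by
  haveI := mono_lift pol hlam ℓ hℓ
  haveI : IsFinite G.hom := isFinite_hom_of_finite_alg G
  haveI : IsFinite Ĝ.hom := isFinite_hom_of_finite_alg Ĝ
  haveI : IsFinite (ℓ.left ≫ Ĝ.hom) := by rw [Over.w ℓ]; infer_instance
  haveI : IsFinite ℓ.left := IsFinite.of_comp ℓ.left Ĝ.hom
  exact (IsClosedImmersion.iff_isFinite_and_mono ℓ.left).mpr ⟨inferInstance, inferInstance⟩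

/-- **The lift `ℓ : G → Ĝ` is an ISOMORPHISM** whenever `Ĝ ≅ G^D` (e.g. through a Weil duality `w`): a closed immersion between finite
`k`-schemes of equal rank `rk Ĝ = rk G^D = rk G` (★ `finrank_alg_eq_of_iso`, ★ `finrank_alg_cartierDual`, ★
`isIso_of_isClosedImmersion_of_finrank_alg_eq`). [cite: MumfordAV1970, §20 p. 186] [cite: Tate1997FiniteFlatGroupSchemes, §(3.8) p. 145] -/
theorem isIso_lift {A : AbelianVariety k} {D : (AbelianScheme.ofAbelianVariety A).toOver.DualPair}
    (pol : (AbelianScheme.ofAbelianVariety A).toOver.Polarization D)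
    {G : SchemeOver k} [GrpObj G] [IsCommMonObj G] [IsAffine G.left] [Module.Free k (Alg G)] [Module.Finite k (Alg G)]
    {j : G ⟶ A.X} [IsMonHom j]
    (hlam : ∀ ⦃T : SchemeOver k⦄ (t : T ⟶ G), (t ≫ j) ≫ pol.lam = 1 → t = 1)
    {Ĝ : SchemeOver k} [GrpObj Ĝ] [IsAffine Ĝ.left] [Module.Finite k (Alg Ĝ)] {ĵ : Ĝ ⟶ D.hat.X} [IsMonHom ĵ] [IsClosedImmersion ĵ.left]
    (ℓ : G ⟶ Ĝ) (hℓ : ℓ ≫ ĵ = j ≫ pol.lam) (w : Ĝ ≅ cartierDual G) : IsIso ℓ := by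
  haveI := isClosedImmersion_lift_left pol hlam ℓ hℓ
  have hrk : Module.finrank k (Alg G) = Module.finrank k (Alg Ĝ) := by
    rw [finrank_alg_eq_of_iso w, finrank_alg_cartierDual]
  exact isIso_of_isClosedImmersion_of_finrank_alg_eq ℓ hrk

/-! ## §2 Hermitian: `β(a†) ≫ (ℓ ≫ w) = (ℓ ≫ w) ≫ (β a)^D` -/

/-- **The dual `f^∨` of an endomorphism lifts to `Ĝ ≅ Â[q]`**: `f^∨` is a homomorphism for a NORMALISED dual pair (★ `isMonHom_dualIsogenyOver`,
unit hypothesis `hD`), so `ĵ ≫ f^∨` is killed by `[q]_Â`. [cite: MumfordAV1970, §15 Thm. 1 (p. 143), §20 p. 186] -/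
theorem exists_lift_dual (p : ℕ) [ExpChar k p] (r : ℕ) (A : AbelianVariety k)
    (D : (AbelianScheme.ofAbelianVariety A).toOver.DualPair)
    (hD : Nonempty ((Scheme.Modules.pullback D.unitHatSlice).obj D.P ≅ SheafOfModules.unit _))
    {Ĝ : SchemeOver k} (ĵ : Ĝ ⟶ D.hat.X)
    (hĜ : ∀ ⦃T : SchemeOver k⦄ (t : T ⟶ D.hat.X),
      (∃ s : T ⟶ Ĝ, s ≫ ĵ = t) ↔ t ≫ ((((p ^ r : ℕ) : ℤ) • 𝟙 D.hat.toAffine.toAbelianVariety).hom.hom.hom) = 1)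
    (f : A ⟶ A) :
    ∃ βd : Ĝ ⟶ Ĝ, βd ≫ ĵ = ĵ ≫ dualIsogenyOver (A' := (AbelianScheme.ofAbelianVariety A).toOver)
      (B := (AbelianScheme.ofAbelianVariety A).toOver) f.hom.hom.hom D D := by
  haveI := isMonHom_dualIsogenyOver (A' := (AbelianScheme.ofAbelianVariety A).toOver)
    (B := (AbelianScheme.ofAbelianVariety A).toOver) f.hom.hom.hom D D hD hD
  refine (hĜ _).mpr ?_
  have h : ĵ ≫ ((((p ^ r : ℕ) : ℤ) • 𝟙 D.hat.toAffine.toAbelianVariety).hom.hom.hom) = 1 :=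
    (hĜ ĵ).mp ⟨𝟙 Ĝ, Category.id_comp ĵ⟩
  have e := comp_zsmul_id_hom_eq (A' := D.hat) (B := D.hat)
    (dualIsogenyOver (A' := (AbelianScheme.ofAbelianVariety A).toOver) (B := (AbelianScheme.ofAbelianVariety A).toOver)
      f.hom.hom.hom D D) ((p ^ r : ℕ) : ℤ)
  rw [Category.assoc, e, ← Category.assoc, h, MonObj.one_comp]

/-- **The Rosati adjunction INTERTWINES the lifts**: `β(a†) ≫ ℓ = ℓ ≫ βd` for any lift `βd` of `ι(a)^∨` (both sides agree after the
monomorphism `ĵ`, by `hβ`, `hRos`, `hℓ`). [cite: MumfordAV1970, §20 (I) (p. 189)] -/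
theorem comp_lift_eq_lift_comp {A : AbelianVariety k} {D : (AbelianScheme.ofAbelianVariety A).toOver.DualPair}
    (pol : (AbelianScheme.ofAbelianVariety A).toOver.Polarization D)
    {G : SchemeOver k} {j : G ⟶ A.X} {Ĝ : SchemeOver k} {ĵ : Ĝ ⟶ D.hat.X} [IsClosedImmersion ĵ.left]
    (ℓ : G ⟶ Ĝ) (hℓ : ℓ ≫ ĵ = j ≫ pol.lam)
    {O : Type} (star : O → O) (act : O → (A ⟶ A)) (β : O → (G ⟶ G))
    (hβ : ∀ a, β a ≫ j = j ≫ (act a).hom.hom.hom)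
    (hRos : ∀ a, (act (star a)).hom.hom.hom ≫ pol.lam =
      pol.lam ≫ dualIsogenyOver (A' := (AbelianScheme.ofAbelianVariety A).toOver) (B := (AbelianScheme.ofAbelianVariety A).toOver)
        (act a).hom.hom.hom D D)
    (a : O) (βd : Ĝ ⟶ Ĝ)
    (hβd : βd ≫ ĵ = ĵ ≫ dualIsogenyOver (A' := (AbelianScheme.ofAbelianVariety A).toOver)
      (B := (AbelianScheme.ofAbelianVariety A).toOver) (act a).hom.hom.hom D D) :
    β (star a) ≫ ℓ = ℓ ≫ βd := by
  haveI := mono_of_isClosedImmersion_left ĵ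
  rw [← cancel_mono ĵ, Category.assoc, Category.assoc, hβd, reassoc_of% hℓ, hℓ, ← Category.assoc (β (star a)) j, hβ,
    Category.assoc, hRos]

/-- **HERMITIAN.**  If `w : Ĝ ≅ G^D` is natural in endomorphisms (`βd ≫ w = w ≫ β^D` for lifts `β` of `f` and `βd` of `f^∨`), then
`e₀ := ℓ ≫ w` satisfies `β(a†) ≫ e₀ = e₀ ≫ (β a)^D` for every `a` — from `hRos a` alone (no `λ^∨ = λ`, no `star ∘ star = id`).
[cite: MumfordAV1970, §20 (I) (p. 189)] -/
theorem hermitian_of_natural (p : ℕ) [ExpChar k p] (r : ℕ) (A : AbelianVariety k)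
    (D : (AbelianScheme.ofAbelianVariety A).toOver.DualPair)
    (hD : Nonempty ((Scheme.Modules.pullback D.unitHatSlice).obj D.P ≅ SheafOfModules.unit _))
    (pol : (AbelianScheme.ofAbelianVariety A).toOver.Polarization D)
    {G : SchemeOver k} [GrpObj G] [IsCommMonObj G] [IsAffine G.left] [Module.Free k (Alg G)] [Module.Finite k (Alg G)] {j : G ⟶ A.X}
    {Ĝ : SchemeOver k} [GrpObj Ĝ] {ĵ : Ĝ ⟶ D.hat.X} [IsClosedImmersion ĵ.left]
    (hĜ : ∀ ⦃T : SchemeOver k⦄ (t : T ⟶ D.hat.X),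
      (∃ s : T ⟶ Ĝ, s ≫ ĵ = t) ↔ t ≫ ((((p ^ r : ℕ) : ℤ) • 𝟙 D.hat.toAffine.toAbelianVariety).hom.hom.hom) = 1)
    (ℓ : G ⟶ Ĝ) (hℓ : ℓ ≫ ĵ = j ≫ pol.lam)
    {O : Type} (star : O → O) (act : O → (A ⟶ A)) (β : O → (G ⟶ G)) [∀ a, IsMonHom (β a)]
    (hβ : ∀ a, β a ≫ j = j ≫ (act a).hom.hom.hom)
    (hRos : ∀ a, (act (star a)).hom.hom.hom ≫ pol.lam =
      pol.lam ≫ dualIsogenyOver (A' := (AbelianScheme.ofAbelianVariety A).toOver) (B := (AbelianScheme.ofAbelianVariety A).toOver)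
        (act a).hom.hom.hom D D)
    (w : Ĝ ≅ cartierDual G)
    (hnat : ∀ (f : A ⟶ A) (β' : G ⟶ G) [IsMonHom β'], β' ≫ j = j ≫ f.hom.hom.hom →
      ∀ (βd : Ĝ ⟶ Ĝ), βd ≫ ĵ = ĵ ≫ dualIsogenyOver (A' := (AbelianScheme.ofAbelianVariety A).toOver)
        (B := (AbelianScheme.ofAbelianVariety A).toOver) f.hom.hom.hom D D → βd ≫ w.hom = w.hom ≫ cartierDualMap β')
    (a : O) : β (star a) ≫ (ℓ ≫ w.hom) = (ℓ ≫ w.hom) ≫ cartierDualMap (β a) := by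
  obtain ⟨βd, hβd⟩ := exists_lift_dual p r A D hD ĵ hĜ (act a)
  rw [← Category.assoc, comp_lift_eq_lift_comp pol ℓ hℓ star act β hβ hRos a βd hβd, Category.assoc,
    hnat (act a) (β a) (hβ a) βd hβd, Category.assoc]

/-! ## §3 Lagrangian: `Φ^{⊥ e₀} = Φ` from the Frobenius-annihilator law and `hlam` -/

/-- The trivial point over the re-based scheme `T′ = (T, F_T^{abs} ≫ str)`: `(1 : T′ → Y) = F_T^{abs} ≫ (1 : T → Y)` on underlying schemes.
[cite: SGA3I, VII_A 4.1] -/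
theorem one_rebase_left (p : ℕ) [ExpChar k p] (r : ℕ) (T : SchemeOver k) (Y : SchemeOver k) [GrpObj Y] :
    (1 : Over.mk (absFrobeniusOver p r T ≫ T.hom) ⟶ Y).left = absFrobeniusOver p r T ≫ (1 : T ⟶ Y).left := by
  have h1 : (toUnit (Over.mk (absFrobeniusOver p r T ≫ T.hom))).left = absFrobeniusOver p r T ≫ T.hom :=
    (Category.comp_id _).symm.trans (Over.w (toUnit (Over.mk (absFrobeniusOver p r T ≫ T.hom))))
  have h2 : (toUnit T).left = T.hom := (Category.comp_id _).symm.trans (Over.w (toUnit T))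
  rw [Hom.one_def, Hom.one_def, Over.comp_left, Over.comp_left, h1, h2, Category.assoc]

/-- **`λ` neither creates nor destroys Frobenius torsion on `A[q]`**: for a `T`-point `x` of `G`, `(x ≫ j ≫ λ) ≫ F^{(r)}_{Â∕k} = 1 ⟺
(x ≫ j) ≫ F^{(r)}_{A∕k} = 1`.  Both sides are read through the absolute-Frobenius criterion ★ `comp_relFrobenius_eq_one_iff` («`t ≫ F = 1 ⟺
F_T^{abs} ≫ t = F_T^{abs} ≫ 1`»); «⟸» is `λ(1) = 1`; «⟹» applies `hlam` to the `T′`-point `F_T^{abs} ≫ x` of `G`, `T′ = (T, F_T^{abs} ≫ str)`.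
[cite: SGA3I, VII_A 4.1] [cite: MumfordAV1970, §23] -/
theorem comp_lam_comp_relFrobenius_eq_one_iff (p : ℕ) [ExpChar k p] (r : ℕ) (A : AbelianVariety k)
    (D : (AbelianScheme.ofAbelianVariety A).toOver.DualPair) (pol : (AbelianScheme.ofAbelianVariety A).toOver.Polarization D)
    {G : SchemeOver k} [GrpObj G] (j : G ⟶ A.X) [IsMonHom j]
    (hlam : ∀ ⦃T : SchemeOver k⦄ (t : T ⟶ G), (t ≫ j) ≫ pol.lam = 1 → t = 1)
    {T : SchemeOver k} (x : T ⟶ G) :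
    ((x ≫ j) ≫ pol.lam) ≫ (D.hat.toAffine.toAbelianVariety.relFrobenius p r).hom.hom.hom = 1 ↔
      (x ≫ j) ≫ (A.relFrobenius p r).hom.hom.hom = 1 := by
  haveI := pol.isMonHom
  rw [AbelianVariety.comp_relFrobenius_eq_one_iff p r D.hat.toAffine.toAbelianVariety ((x ≫ j) ≫ pol.lam),
    AbelianVariety.comp_relFrobenius_eq_one_iff p r A (x ≫ j)]
  have h1G : absFrobeniusOver p r T ≫ (1 : T ⟶ G).left ≫ j.left = absFrobeniusOver p r T ≫ (1 : T ⟶ A.X).left := by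
    rw [← Over.comp_left, MonObj.one_comp]
  have h1A : absFrobeniusOver p r T ≫ (1 : T ⟶ A.X).left ≫ pol.lam.left =
      absFrobeniusOver p r T ≫ (1 : T ⟶ D.hat.toAffine.toAbelianVariety.X).left := by
    rw [← Over.comp_left, MonObj.one_comp]
  constructor
  · intro h
    -- the `T′`-point `F_T^{abs} ≫ x` of `G`, `T′ := (T, F_T^{abs} ≫ str)`
    let x' : Over.mk (absFrobeniusOver p r T ≫ T.hom) ⟶ G := Over.homMk (absFrobeniusOver p r T ≫ x.left) (by
      change (absFrobeniusOver p r T ≫ x.left) ≫ G.hom = absFrobeniusOver p r T ≫ T.hom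
      rw [Category.assoc, Over.w x])
    have hx'l : x'.left = absFrobeniusOver p r T ≫ x.left := rfl
    have hx' : (x' ≫ j) ≫ pol.lam = 1 := by
      ext : 1
      rw [one_rebase_left, Over.comp_left, Over.comp_left, hx'l, Category.assoc, Category.assoc]
      rw [Over.comp_left, Over.comp_left, Category.assoc] at h
      exact h
    have h2 := congrArg (fun g => Over.Hom.left g) (hlam x' hx')
    change x'.left = (1 : Over.mk (absFrobeniusOver p r T ≫ T.hom) ⟶ G).left at h2
    rw [hx'l, one_rebase_left] at h2
    rw [Over.comp_left, ← Category.assoc, h2, Category.assoc, h1G]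
  · intro h
    rw [Over.comp_left, ← Category.assoc, h, Category.assoc, h1A]

/-- **LAGRANGIAN.**  If `w : Ĝ ≅ G^D` annihilates Frobenius — for every realisation `φ′ : Φ′ ↪ Ĝ` of `Â[F_q]`, a `T`-point of `Ĝ` lies in
`Φ^{⊥_w}` iff it lies in `Φ′` — then for `e₀ := ℓ ≫ w` (`ℓ` an isomorphism) the layer `Φ = A[F_q]` is its own `e₀`-annihilator:
`x ∈ Φ^{⊥ e₀} ⟺ ℓ x ∈ Φ^{⊥ w} ⟺ ℓ x ∈ Â[F_q] ⟺ (x ≫ j ≫ λ) ≫ F_Â = 1 ⟺ (x ≫ j) ≫ F_A = 1 ⟺ x ∈ Φ` (`Φ′ := Ker (ĵ ≫ F_Â)`, ★ `ker`;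
§3 `comp_lam_comp_relFrobenius_eq_one_iff`). [cite: Oda1969, Cor. 1.3] [cite: MumfordAV1970, §23] -/
theorem lagrangian_of_frobeniusAnnihilates (p : ℕ) [ExpChar k p] (r : ℕ) (A : AbelianVariety k)
    (D : (AbelianScheme.ofAbelianVariety A).toOver.DualPair) (pol : (AbelianScheme.ofAbelianVariety A).toOver.Polarization D)
    {G : SchemeOver k} [GrpObj G] [IsCommMonObj G] [IsAffine G.left] [Module.Free k (Alg G)] [Module.Finite k (Alg G)]
    (j : G ⟶ A.X) [IsMonHom j]
    (hlam : ∀ ⦃T : SchemeOver k⦄ (t : T ⟶ G), (t ≫ j) ≫ pol.lam = 1 → t = 1)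
    {Ĝ : SchemeOver k} [GrpObj Ĝ] [IsCommMonObj Ĝ] [IsAffine Ĝ.left] [Module.Finite k (Alg Ĝ)]
    (ĵ : Ĝ ⟶ D.hat.X) [IsMonHom ĵ]
    (ℓ : G ⟶ Ĝ) [IsIso ℓ] (hℓ : ℓ ≫ ĵ = j ≫ pol.lam)
    {Φ : SchemeOver k} [GrpObj Φ] [IsCommMonObj Φ] [IsAffine Φ.left] [Module.Free k (Alg Φ)] [Module.Finite k (Alg Φ)]
    (φ : Φ ⟶ G) [IsMonHom φ]
    (hΦ : ∀ ⦃T : SchemeOver k⦄ (t : T ⟶ G), (∃ s : T ⟶ Φ, s ≫ φ = t) ↔ (t ≫ j) ≫ (A.relFrobenius p r).hom.hom.hom = 1)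
    (w : Ĝ ≅ cartierDual G)
    (hF : ∀ (Φ' : SchemeOver k) [GrpObj Φ'] [IsCommMonObj Φ'] [IsAffine Φ'.left] [Module.Free k (Alg Φ')] [Module.Finite k (Alg Φ')]
      (φ' : Φ' ⟶ Ĝ) [IsMonHom φ'] [IsClosedImmersion φ'.left],
      (∀ ⦃T : SchemeOver k⦄ (t : T ⟶ Ĝ),
        (∃ s : T ⟶ Φ', s ≫ φ' = t) ↔ (t ≫ ĵ) ≫ (D.hat.toAffine.toAbelianVariety.relFrobenius p r).hom.hom.hom = 1) →
      ∀ ⦃T : SchemeOver k⦄ (x : T ⟶ Ĝ),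
        (∃ c : T ⟶ annihilator φ, c ≫ (annihilatorι φ ≫ w.inv) = x) ↔ ∃ s : T ⟶ Φ', s ≫ φ' = x)
    {T : SchemeOver k} (x : T ⟶ G) :
    (∃ c : T ⟶ annihilator φ, c ≫ (annihilatorι φ ≫ (asIso ℓ ≪≫ w).inv) = x) ↔ ∃ s : T ⟶ Φ, s ≫ φ = x := by
  -- the realisation `Φ′ := Ker (ĵ ≫ F_Â)` of `Â[F_q]` inside `Ĝ`
  let Fh : D.hat.X ⟶ (D.hat.toAffine.toAbelianVariety.frobeniusTwist p r).X :=
    (D.hat.toAffine.toAbelianVariety.relFrobenius p r).hom.hom.hom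
  haveI : IsFinite Ĝ.hom := isFinite_hom_of_finite_alg Ĝ
  haveI : IsCommMonObj (ker (ĵ ≫ Fh)) := isCommMonObj_ker (ĵ ≫ Fh)
  haveI : IsClosedImmersion (kerι (ĵ ≫ Fh)).left := isClosedImmersion_kerι_left_of_isSeparated (ĵ ≫ Fh)
  haveI : IsAffine (ker (ĵ ≫ Fh)).left := isAffine_of_isAffineHom (kerι (ĵ ≫ Fh)).left
  haveI : IsFinite (ker (ĵ ≫ Fh)).hom := by
    rw [← Over.w (kerι (ĵ ≫ Fh))]
    infer_instance
  haveI : Module.Finite k (Alg (ker (ĵ ≫ Fh))) := Alg.moduleFinite (ker (ĵ ≫ Fh))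
  have hΦ' : ∀ ⦃T : SchemeOver k⦄ (t : T ⟶ Ĝ), (∃ s : T ⟶ ker (ĵ ≫ Fh), s ≫ kerι (ĵ ≫ Fh) = t) ↔ (t ≫ ĵ) ≫ Fh = 1 := by
    intro T t
    rw [exists_comp_kerι_eq_iff, Category.assoc]
  have hFx := hF (ker (ĵ ≫ Fh)) (kerι (ĵ ≫ Fh)) hΦ' (x ≫ ℓ)
  -- `x ∈ Φ^{⊥ e₀} ⟺ ℓ x ∈ Φ^{⊥ w}`
  have step1 : (∃ c : T ⟶ annihilator φ, c ≫ (annihilatorι φ ≫ (asIso ℓ ≪≫ w).inv) = x) ↔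
      ∃ c : T ⟶ annihilator φ, c ≫ (annihilatorι φ ≫ w.inv) = x ≫ ℓ := by
    refine exists_congr fun c => ?_
    rw [Iso.trans_inv, asIso_inv, ← Category.assoc (annihilatorι φ), ← Category.assoc c, IsIso.comp_inv_eq]
  rw [step1, hFx, hΦ', Category.assoc x ℓ ĵ, hℓ, ← Category.assoc x j, comp_lam_comp_relFrobenius_eq_one_iff p r A D pol j hlam x,
    hΦ]

/-! ## §4 Head -/

/-- **(T-W3) POLARIZATION TRANSPORT.**  Over a field of exponential characteristic `p`, `q = p^r`: given an abelian variety `A` with a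
normalised dual pair `D` (`hD`) and a polarization `λ`, realisations `G ≅ A[q]`, `Ĝ ≅ Â[q]`, `Φ ≅ A[F_q]` (all-`T`), `hlam` («`λ|_{A[q]}` kills no
non-trivial `T`-point»), labels `O` with `star`, `act`, lifts `β` (`hβ`) and the Rosati adjunction `hRos`, and a homomorphic duality `w : Ĝ ≅ G^D`
NATURAL IN ENDOMORPHISMS and ANNIHILATING FROBENIUS, there is a duality `e₀ : G ≅ G^D` — a homomorphism, HERMITIAN (`β(star a) ≫ e₀ = e₀ ≫ (β a)^D`)
and with `Φ` ITS OWN `e₀`-ANNIHILATOR (points form) — verbatim the conclusion of the head type `WeilCartierDualityLagrangian` of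
`Lines/F0_P6b_WeilCartierDuality.lean`, i.e. the hypotheses `(e₀, hherm₀, hlag₀)` of (BLF); `e₀ := ℓ ≫ w` with `ℓ` the lift of `λ|_{A[q]}` (§1–§3).
[cite: MumfordAV1970, §20 (I) (p. 189), §23] [cite: Oda1969, Cor. 1.3] -/
theorem exists_hermitian_lagrangian_duality_of_weil (p : ℕ) [ExpChar k p] (r : ℕ) (A : AbelianVariety k)
    (D : (AbelianScheme.ofAbelianVariety A).toOver.DualPair)
    (hD : Nonempty ((Scheme.Modules.pullback D.unitHatSlice).obj D.P ≅ SheafOfModules.unit _))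
    (pol : (AbelianScheme.ofAbelianVariety A).toOver.Polarization D)
    {G : SchemeOver k} [GrpObj G] [IsCommMonObj G] [IsAffine G.left] [Module.Free k (Alg G)] [Module.Finite k (Alg G)]
    (j : G ⟶ A.X) [IsMonHom j]
    (hG : ∀ ⦃T : SchemeOver k⦄ (t : T ⟶ A.X), (∃ s : T ⟶ G, s ≫ j = t) ↔ t ≫ ((((p ^ r : ℕ) : ℤ) • 𝟙 A).hom.hom.hom) = 1)
    (hlam : ∀ ⦃T : SchemeOver k⦄ (t : T ⟶ G), (t ≫ j) ≫ pol.lam = 1 → t = 1)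
    {Ĝ : SchemeOver k} [GrpObj Ĝ] [IsCommMonObj Ĝ] [IsAffine Ĝ.left] [Module.Finite k (Alg Ĝ)]
    (ĵ : Ĝ ⟶ D.hat.X) [IsMonHom ĵ] [IsClosedImmersion ĵ.left]
    (hĜ : ∀ ⦃T : SchemeOver k⦄ (t : T ⟶ D.hat.X),
      (∃ s : T ⟶ Ĝ, s ≫ ĵ = t) ↔ t ≫ ((((p ^ r : ℕ) : ℤ) • 𝟙 D.hat.toAffine.toAbelianVariety).hom.hom.hom) = 1)
    (w : Ĝ ≅ cartierDual G) [IsMonHom w.hom]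
    (hnat : ∀ (f : A ⟶ A) (β' : G ⟶ G) [IsMonHom β'], β' ≫ j = j ≫ f.hom.hom.hom →
      ∀ (βd : Ĝ ⟶ Ĝ), βd ≫ ĵ = ĵ ≫ dualIsogenyOver (A' := (AbelianScheme.ofAbelianVariety A).toOver)
        (B := (AbelianScheme.ofAbelianVariety A).toOver) f.hom.hom.hom D D → βd ≫ w.hom = w.hom ≫ cartierDualMap β')
    {Φ : SchemeOver k} [GrpObj Φ] [IsCommMonObj Φ] [IsAffine Φ.left] [Module.Free k (Alg Φ)] [Module.Finite k (Alg Φ)]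
    (φ : Φ ⟶ G) [IsMonHom φ]
    (hΦ : ∀ ⦃T : SchemeOver k⦄ (t : T ⟶ G), (∃ s : T ⟶ Φ, s ≫ φ = t) ↔ (t ≫ j) ≫ (A.relFrobenius p r).hom.hom.hom = 1)
    (hF : ∀ (Φ' : SchemeOver k) [GrpObj Φ'] [IsCommMonObj Φ'] [IsAffine Φ'.left] [Module.Free k (Alg Φ')] [Module.Finite k (Alg Φ')]
      (φ' : Φ' ⟶ Ĝ) [IsMonHom φ'] [IsClosedImmersion φ'.left],
      (∀ ⦃T : SchemeOver k⦄ (t : T ⟶ Ĝ),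
        (∃ s : T ⟶ Φ', s ≫ φ' = t) ↔ (t ≫ ĵ) ≫ (D.hat.toAffine.toAbelianVariety.relFrobenius p r).hom.hom.hom = 1) →
      ∀ ⦃T : SchemeOver k⦄ (x : T ⟶ Ĝ),
        (∃ c : T ⟶ annihilator φ, c ≫ (annihilatorι φ ≫ w.inv) = x) ↔ ∃ s : T ⟶ Φ', s ≫ φ' = x)
    (O : Type) (star : O → O) (act : O → (A ⟶ A)) (β : O → (G ⟶ G)) [∀ a, IsMonHom (β a)]
    (hβ : ∀ a, β a ≫ j = j ≫ (act a).hom.hom.hom)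
    (hRos : ∀ a, (act (star a)).hom.hom.hom ≫ pol.lam =
      pol.lam ≫ dualIsogenyOver (A' := (AbelianScheme.ofAbelianVariety A).toOver) (B := (AbelianScheme.ofAbelianVariety A).toOver)
        (act a).hom.hom.hom D D) :
    ∃ e₀ : G ≅ cartierDual G, IsMonHom e₀.hom ∧
      (∀ a : O, β (star a) ≫ e₀.hom = e₀.hom ≫ cartierDualMap (β a)) ∧
      ∀ ⦃T : SchemeOver k⦄ (x : T ⟶ G),
        (∃ c : T ⟶ annihilator φ, c ≫ (annihilatorι φ ≫ e₀.inv) = x) ↔ ∃ s : T ⟶ Φ, s ≫ φ = x := by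
  obtain ⟨ℓ, hℓ⟩ := exists_lift_lam p r A D pol j hG ĵ hĜ
  haveI := isIso_lift pol hlam ℓ hℓ w
  haveI := isMonHom_lift pol ℓ hℓ
  refine ⟨asIso ℓ ≪≫ w, ?_, ?_, ?_⟩
  · rw [Iso.trans_hom, asIso_hom]
    infer_instance
  · intro a
    rw [Iso.trans_hom, asIso_hom]
    exact hermitian_of_natural p r A D hD pol hĜ ℓ hℓ star act β hβ hRos w hnat a
  · intro T x
    exact lagrangian_of_frobeniusAnnihilates p r A D pol j hlam ĵ ℓ hℓ φ hΦ w hF x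

end DualPair

end AbelianSchemeOver

end Literature.AlgebraicGeometry.AbelianSchemes

end
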